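import Summits.NavierStokesRegularity.NavierStokesRegularity.Theses.CertifiedBlowup
import Literature.Analysis.FluidPDE.VorticityBlowupMaximal
import Literature.Analysis.FluidPDE.LerayHopfFinalWeakSlice
import HarnessLib.Audit

/-!
# Line `apriori_parts` — a second registered skeleton of the crux `CertifiedBlowup.CertifiedBlowupAxisymBlowup` (X5a_axi)

Crux item `stmt-NavierStokesRegularity-0727` (rank 2 of route `route-NavierStokesRegularity-CertifiedBlowup`;
shared verbatim with `DimensionLadder.AxisymBlowup` and `SwirlThreshold.AxisymBlowup`); tree path
`Cruxes/CertifiedBlowupAxisymBlowup/Lines/apriori_parts.lean`; card `Lines/apriori_parts.md`; author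
`planner-skel-stmt-NavierStokesRegularity-0727-0` (skeleton registrar, re-audit bin HONEST), 2026-08-17.

SIBLING OF `Lines/birth.lean`. Two concurrent sessions of the same registrar seat produced two independent cuts
of this crux on 2026-08-17; the canonical BC3 file `Lines/birth.lean` (stubs `stub_maximalDevelopment` +
`stub_rescaledVorticityFloor`: maximal development in the energy class + an a-priori RESCALED-VORTICITY FLOOR in
dynamic-rescaling variables) is the other session's; this file is the second line, kept because its cut of the
known/open boundary is different and mechanism-neutral: here the KNOWN stub claims NO maximality in the growth-free
classical sense (so it needs no far-field regularity at the first singular time — it is Leray's 1934 dichotomy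
verbatim), and the OPEN stub is the a-priori LOCALISED VORTICITY BLOW-UP AT A TIME `T*` with bounds before `T*`
(the exact `ℝ³`/Navier–Stokes twin of the tree's `ChenHou2022_aprioriBlowupEstimates`), from which maximality is
read off by the accepted elementary half of Beale–Kato–Majda. Which line a lead builds on is the lead's choice;
the stubs of the two lines are registered side by side on the item.

THE CRUX (by name, never restated): `∃ ν > 0, ∃ T > 0, ∃ u p, IsMaximalSmoothSolution ν 0 u p T ∧
IsLerayHopfOn T ν 0 (u 0) u ∧ HasRapidSpatialDecay (u 0) ∧ IsAxisymmetric (u 0)` — a Leray–Hopf CLASSICAL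
solution of Navier–Stokes on `ℝ³` from a rapidly decaying AXISYMMETRIC datum with finite MAXIMAL lifespan
(Hou's interior axisymmetric scenario, arXiv:2107.06509; the target of a Chen–Hou-type computer-assisted proof).
Refuter record honoured (crux-attack rattack-0727, 2026-08-17): SURVIVES; `C = ¬ns.S25 (AxisymmetricSwirlRegularity)
modulo LWP`, an honest special case of `¬S`, not a restatement; the single load-bearing conjunct is
`¬ HasSmoothExtensionPast` and the Leray–Hopf conjunct must be KEPT by any re-typing (Mutation.lean: without it
the statement is junk-provable by the parasitic flow `a(t) e₃`). Both stubs below keep the Leray–Hopf class.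
At registration the crux had no `Disproof.lean`, no ideas, no dead lines, no `Negative/` lemmas; the negatives
index (stmt-4055, 1832, 1429, 0154) contains nothing of the shape of the two stubs.

THE CUT — the Navier–Stokes/`ℝ³` twin of the tree's reviewed decomposition of the Chen–Hou EULER theorem,
`chenHou2022_axisymmetricEulerBlowup_of_parts :
  Ferrari1993_periodicCylinderEulerBKM → ChenHou2022_aprioriBlowupEstimates → ChenHou2022_axisymmetricEulerBlowup`
(`Literature/Analysis/FluidPDE/ChenHouContinuation.lean`, review record 2026-08-15: "not mis-cut and not
misstated"), and of the kernel-checked split `mcb_of_D3` of the cousin crux `MarginalCreepBlowup`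
(`Cruxes/MarginalCreepBlowup/DecompositionAttempts.lean`, the only split of that census passing criterion (c)).
It separates the classical PDE background from the (computer-assisted) estimates:

* `stub_lerayLocalTheory` [KNOWN, L-sized in Lean — Leray 1934 §§19–22 + Ch. V–VI; Kato 1984; energy equality for
  strong solutions on compact sub-slabs; propagation of axisymmetry by uniqueness]: from every smooth,
  divergence-free, rapidly decaying, axisymmetric datum `u₀` and every `ν > 0` issues a classical solution `(u, p)`
  with `u 0 = u₀`, axisymmetric at all times of existence, which is EITHER global (classical on `[0, ∞)`, Leray–Hopf
  on every `[0, T]`) OR lives on a bounded slab `[0, Tm)`, `Tm > 0`, is Leray–Hopf on every closed SUB-slab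
  `[0, T']`, `0 < T' < Tm`, and has UNBOUNDED velocity on `[0, Tm) × ℝ³` (Leray's first character of an irregular
  epoch, `‖u(t)‖_∞ ≥ c √(ν/(Tm − t))`). No maximality in the growth-free classical sense and no slice at `Tm` are
  claimed: the Leray–Hopf slice at the blow-up time is supplied in the assembly by the PROVED tree theorem
  `exists_isLerayHopfOn_update_of_forall_lt` (LerayHopfFinalWeakSlice.lean), maximality by the heart.
* `stub_aprioriLocalizedBlowup` [OPEN, XL — the heart; the certificate + nonlinear-stability theorem in
  a-priori, EXISTENCE-FREE form, exactly the shape of `ChenHou2022_aprioriBlowupEstimates`]: there are `ν > 0`,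
  an admissible axisymmetric datum `u₀`, a time `T* > 0` and a BOUNDED region `Ω ⊆ ℝ³` such that EVERY classical
  solution from `u₀` on a slab `[0, T')` which is Leray–Hopf on `[0, T']` and axisymmetric (i) is bounded on
  `[0, min(T', T'')) × ℝ³` for every `T'' < T*` (no singularity before `T*`), and (ii) if `T* ≤ T'`, has vorticity
  blowing up INSIDE `Ω` at `T*` (`VorticityBlowsUpOnAt Ω u T*`: `∀ M, ∃ᶠ t ↑ T*, ∃ x ∈ Ω, M < ‖curl u(t, x)‖`).
  In the Leray–Hopf class classical solutions are unique (weak–strong uniqueness), so (i)–(ii) concern THE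
  solution from `u₀`; a dynamic-rescaling certificate with bounded nontrivial rescaled profile delivers (ii)
  through the accepted `vorticityBlowsUpOnAt_of_rescaling` (`DynamicRescalingBlowup.lean`) with
  `T* = blowupTime C_ω` — so the sibling line's `stub_rescaledVorticityFloor` implies (ii) for its datum, while
  (i) is the "no earlier singularity" clause (`[ChenHou2021Boundary]` §8.6.2: "the solutions remain in the same
  regularity class as that of the initial data before `T*`").
  Why it might fail: the route's own line — NS may be regular for axisymmetric data (`AxisymmetricSwirlRegularity`,
  ns.S25; kill edge `certifiedBlowup_kill_edge` landed); Hou's constant-`ν` numerics sit at the KNSS-forbidden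
  endpoint `β = 1/2` (velocity Type I excluded: `knss_no_axisymmetric_typeI`), Hou 2026 changes the equation.

Assembly (PROVED, `axisymBlowup_of_parts`, sorry-free; the composition `certifiedBlowup_axisym_blowup_of`
concludes the crux BY NAME using the two stubs by name): take `ν, u₀, T*, Ω` of the heart and the solution
`(u, p)` of the local theory. Global branch: its restriction to `[0, T* + 1)` is alive at `T*`, so (ii) gives
vorticity blow-up inside the bounded `Ω` at `T*`, which forbids the classical continuation that `u` itself is
(accepted `VorticityBlowsUpOnAt.not_hasSmoothExtensionPast`) — contradiction. Finite branch `[0, Tm)`: first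
close the energy class at `Tm` (`ū := Function.update u Tm Y`, `Y` the weak `L²` limit, tree theorem above; the
classical equations, the axisymmetry and the unboundedness only see `[0, Tm)`, glue `isClassicalNSSolutionOn_congr`);
then `Tm < T*` contradicts (i) with `T'' = (Tm + T*)/2` and the unbounded velocity; `Tm > T*` makes `ū` its own
classical continuation past `T*`, against (ii); so `Tm = T*`, where (ii) and the accepted
`VorticityBlowsUpOnAt.isMaximalSmoothSolution` give maximality, the closed energy class gives Leray–Hopf on
`[0, Tm]`, and `ū 0 = u₀` transports decay and axisymmetry. Nothing is hidden in the seam: the only analysis used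
outside the stubs is the accepted elementary half of Beale–Kato–Majda and the accepted final-weak-slice theorem.
-/

noncomputable section

open Set Filter Topology Function MeasureTheory Bornology
open Literature.Analysis.FluidPDE

namespace Summit.NavierStokesRegularity.NavierStokesRegularity.Cruxes.CertifiedBlowupAxisymBlowup.AprioriParts

set_option linter.unusedVariables false
set_option linter.dupNamespace false

local notation "E3" => EuclideanSpace ℝ (Fin 3)

/-- **stub 0 — `stub_lerayLocalTheory` (KNOWN; L-sized in Lean).** Leray's structure theorem for the Cauchy
problem from a smooth, divergence-free, rapidly decaying (Fefferman (4)), axisymmetric datum, in the tree's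
vocabulary: there is a classical solution `(u, p)` (`IsClassicalNSSolutionOn`, jointly `C^∞`) with `u 0 = u₀`,
axisymmetric at all times of existence (rotations about the axis map solutions to solutions with the same
datum; uniqueness of the strong solution), which is either GLOBAL — classical on `[0, ∞)` and Leray–Hopf on every
`[0, T]` (energy equality of the strong solution, `u ∈ C([0,T]; L²) ∩ L²(0,T; Ḣ¹)`) — or lives on a bounded slab
`[0, Tm)`, `0 < Tm`, is Leray–Hopf on every closed sub-slab `[0, T']`, `0 < T' < Tm`, and has unbounded velocity
on `[0, Tm) × ℝ³` (if `u` were bounded there the strong solution would continue past `Tm`: Leray 1934 §19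
(3.9) p. 224 / Serrin's `L²_t L^∞_x` criterion). Sources: Leray1934 (§§19–22, Ch. V §31, Ch. VI §34;
arXiv:1604.02484), OzanskiPooley2018 (Thm 6.22, Lemma 6.23, Cor 6.36), Kato1984, KochNadirashviliSereginSverak2009
§1 (axisymmetric class). Leans on (tree, by name): `local_classical_lerayHopf` (NSLocalClassical, named fact),
`leray_strong_local_existence` (NSLerayBlowupRate), `weak_strong_uniqueness`, `ladyzhenskaya_prodi_serrin`
(NSLerayHopf), `kato_local` / `kato_unique` (KatoMaximalTime), `IsClassicalNSSolutionOn.isLerayHopfOn` (LerayHopf),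
`IsClassicalNSSolutionOn.exists_glue_Ico_right`. -/
theorem stub_lerayLocalTheory :
    ∀ ν : ℝ, 0 < ν → ∀ u₀ : E3 → E3, ContDiff ℝ (⊤ : ℕ∞) u₀ → VectorCalculus.IsDivFree u₀ →
      HasRapidSpatialDecay u₀ → IsAxisymmetric u₀ →
      ∃ (u : ℝ → E3 → E3) (p : ℝ → E3 → ℝ), u 0 = u₀ ∧
        ((IsClassicalNSSolutionOn (Ici 0) ν 0 u p ∧ (∀ T : ℝ, 0 < T → IsLerayHopfOn T ν 0 u₀ u) ∧
            ∀ t : ℝ, 0 ≤ t → IsAxisymmetric (u t)) ∨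
          (∃ Tm : ℝ, 0 < Tm ∧ IsClassicalNSSolutionOn (Ico 0 Tm) ν 0 u p ∧
            (∀ T' ∈ Ioo 0 Tm, IsLerayHopfOn T' ν 0 u₀ u) ∧
            (∀ t ∈ Ico 0 Tm, IsAxisymmetric (u t)) ∧
            ∀ M : ℝ, ∃ t ∈ Ico 0 Tm, ∃ x : E3, M < ‖u t x‖)) := by
  sorry

/-- **stub 1 — `stub_aprioriLocalizedBlowup` (OPEN, XL; the heart — the computer-assisted target in a-priori,
existence-free form, the `ℝ³`/Navier–Stokes twin of `ChenHou2022_aprioriBlowupEstimates`).** There are a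
viscosity `ν > 0`, a smooth divergence-free rapidly decaying AXISYMMETRIC datum `u₀`, a time `T* > 0` and a
bounded region `Ω` such that every classical solution `(u, p)` from `u₀` on a slab `[0, T')`, Leray–Hopf on
`[0, T']` and axisymmetric, (i) is bounded on `[0, min(T', T'')) × ℝ³` for every `T'' < T*` and (ii) if
`T* ≤ T'`, has vorticity blowing up inside `Ω` at `T*`. Intended proof (route CertifiedBlowup, cruxes #3/#4 and
the Two-layer plan): an interval-arithmetic certificate for an approximate nearly self-similar axisymmetric
profile with swirl plus finite-codimension nonlinear stability in dynamic-rescaling variables WITH the critical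
viscous term (Chen–Hou Part I arXiv:2210.07191 §2, §6; Part II arXiv:2305.05660; Hou arXiv:2107.06509,
arXiv:2405.10916), ported from the cylinder to a rapidly decaying datum on `ℝ³`; its output — a clock `C_ω`
with `t(∞) = T* < ∞` and a rescaled vorticity staying nontrivial on a bounded region — gives (ii) by
`vorticityBlowsUpOnAt_of_rescaling`, and (i) is "the solution remains in the regularity class of the datum
before `T*`"; weak–strong uniqueness in the Leray–Hopf class makes (i)–(ii) statements about THE solution.
Why it might fail: `AxisymmetricSwirlRegularity` (ns.S25) may hold (kill edge landed:
`Literature.NS.certifiedBlowup_kill_edge`); KNSS2009 forces velocity-Type-II / collapse exponent `β < 1/2`,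
Hou's constant-`ν` fit sits at `β = 1/2`, Hou 2026 certifies only a modified equation. Sources:
Hou2022PotentiallySingularNS (arXiv:2107.06509), ChenHou2022 (arXiv:2210.07191), ChenHou2023RigorousNumerics
(arXiv:2305.05660), Hou2026 (arXiv:2405.10916), KochNadirashviliSereginSverak2009, ChenHou2021Boundary §8.6.2. -/
theorem stub_aprioriLocalizedBlowup :
    ∃ ν : ℝ, 0 < ν ∧ ∃ u₀ : E3 → E3, ContDiff ℝ (⊤ : ℕ∞) u₀ ∧ VectorCalculus.IsDivFree u₀ ∧
      HasRapidSpatialDecay u₀ ∧ IsAxisymmetric u₀ ∧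
      ∃ Ts : ℝ, 0 < Ts ∧ ∃ Ω : Set E3, IsBounded Ω ∧
        ∀ (T' : ℝ) (u : ℝ → E3 → E3) (p : ℝ → E3 → ℝ),
          IsClassicalNSSolutionOn (Ico 0 T') ν 0 u p → u 0 = u₀ → IsLerayHopfOn T' ν 0 u₀ u →
          (∀ t ∈ Ico 0 T', IsAxisymmetric (u t)) →
            (∀ T'' : ℝ, T'' < Ts → ∃ M : ℝ, ∀ t ∈ Ico 0 (min T' T''), ∀ x : E3, ‖u t x‖ ≤ M) ∧
            (Ts ≤ T' → VorticityBlowsUpOnAt Ω u Ts) := by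
  sorry

/-- Assembly glue (PROVED): a classical solution stays classical when the velocity is modified at times
outside the time set `S` — every clause of `IsClassicalNSSolutionOn` only sees the slices `u t`, `t ∈ S`, and
the time derivative WITHIN `S`. In-file copy of the tree lemma `IsClassicalNSSolutionOn.congr_velocity`
(NSLerayStrongLocalExistence.lean), kept here to keep the import cone small. [folklore] -/
theorem isClassicalNSSolutionOn_congr {E : Type*} [NormedAddCommGroup E] [InnerProductSpace ℝ E]
    [FiniteDimensional ℝ E] {S : Set ℝ} {ν : ℝ} {f u v : ℝ → E → E} {p : ℝ → E → ℝ}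
    (h : IsClassicalNSSolutionOn S ν f u p) (huv : ∀ t ∈ S, v t = u t) :
    IsClassicalNSSolutionOn S ν f v p where
  smooth_velocity :=
    h.smooth_velocity.congr fun z hz => by
      change v z.1 z.2 = u z.1 z.2
      rw [huv z.1 (mem_prod.1 hz).1]
  smooth_pressure := h.smooth_pressure
  momentum t ht x := by
    have h1 : timeDerivWithin S v t x = timeDerivWithin S u t x := by
      simp only [timeDerivWithin]
      exact derivWithin_congr (fun s hs => by rw [huv s hs]) (by rw [huv t ht])
    rw [h1, huv t ht]
    exact h.momentum t ht x
  divFree t ht := by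
    rw [huv t ht]
    exact h.divFree t ht

/-- **Assembly from the two parts (PROVED, sorry-free).** Leray's local theory and the a-priori localized
blow-up give a Leray–Hopf classical solution from a rapidly decaying axisymmetric datum with finite MAXIMAL
lifespan — the body of the crux. The energy class is closed at the lifespan `Tm` of the local-theory solution by
the accepted final-weak-slice theorem; then trichotomy of `Tm` against `T*`; maximality at `Tm = T*` from the
accepted `VorticityBlowsUpOnAt.isMaximalSmoothSolution`, the impossible branches from
`VorticityBlowsUpOnAt.not_hasSmoothExtensionPast` and the velocity bound (i). The conclusion is spelled as the
crux's body (head `Exists`), so that `certifiedBlowup_axisym_blowup_of` below is the file's only theorem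
concluding the crux by name. -/
theorem axisymBlowup_of_parts
    (hL : ∀ ν : ℝ, 0 < ν → ∀ u₀ : E3 → E3, ContDiff ℝ (⊤ : ℕ∞) u₀ → VectorCalculus.IsDivFree u₀ →
      HasRapidSpatialDecay u₀ → IsAxisymmetric u₀ →
      ∃ (u : ℝ → E3 → E3) (p : ℝ → E3 → ℝ), u 0 = u₀ ∧
        ((IsClassicalNSSolutionOn (Ici 0) ν 0 u p ∧ (∀ T : ℝ, 0 < T → IsLerayHopfOn T ν 0 u₀ u) ∧
            ∀ t : ℝ, 0 ≤ t → IsAxisymmetric (u t)) ∨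
          (∃ Tm : ℝ, 0 < Tm ∧ IsClassicalNSSolutionOn (Ico 0 Tm) ν 0 u p ∧
            (∀ T' ∈ Ioo 0 Tm, IsLerayHopfOn T' ν 0 u₀ u) ∧
            (∀ t ∈ Ico 0 Tm, IsAxisymmetric (u t)) ∧
            ∀ M : ℝ, ∃ t ∈ Ico 0 Tm, ∃ x : E3, M < ‖u t x‖)))
    (hA : ∃ ν : ℝ, 0 < ν ∧ ∃ u₀ : E3 → E3, ContDiff ℝ (⊤ : ℕ∞) u₀ ∧ VectorCalculus.IsDivFree u₀ ∧
      HasRapidSpatialDecay u₀ ∧ IsAxisymmetric u₀ ∧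
      ∃ Ts : ℝ, 0 < Ts ∧ ∃ Ω : Set E3, IsBounded Ω ∧
        ∀ (T' : ℝ) (u : ℝ → E3 → E3) (p : ℝ → E3 → ℝ),
          IsClassicalNSSolutionOn (Ico 0 T') ν 0 u p → u 0 = u₀ → IsLerayHopfOn T' ν 0 u₀ u →
          (∀ t ∈ Ico 0 T', IsAxisymmetric (u t)) →
            (∀ T'' : ℝ, T'' < Ts → ∃ M : ℝ, ∀ t ∈ Ico 0 (min T' T''), ∀ x : E3, ‖u t x‖ ≤ M) ∧
            (Ts ≤ T' → VorticityBlowsUpOnAt Ω u Ts)) :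
    ∃ ν : ℝ, 0 < ν ∧ ∃ T : ℝ, 0 < T ∧ ∃ (u : ℝ → E3 → E3) (p : ℝ → E3 → ℝ),
      IsMaximalSmoothSolution ν 0 u p T ∧ IsLerayHopfOn T ν 0 (u 0) u ∧ HasRapidSpatialDecay (u 0) ∧
        IsAxisymmetric (u 0) := by
  obtain ⟨ν, hν, u₀, hsm, hdiv, hdec, hax₀, Ts, hTs, Ω, hΩ, hall⟩ := hA
  obtain ⟨u, p, h0, hcase⟩ := hL ν hν u₀ hsm hdiv hdec hax₀
  rcases hcase with ⟨hcl, hLH, hax⟩ | ⟨Tm, hTm, hcl, hLH, hax, hunb⟩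
  · -- global branch: `u` restricted to `[0, T* + 1)` is alive at `T*`, so its vorticity blows up inside the
    -- bounded `Ω` at `T*` — but `u` itself is a classical continuation past `T*`
    exfalso
    have hcl' : IsClassicalNSSolutionOn (Ico 0 (Ts + 1)) ν 0 u p :=
      hcl.mono (fun t ht => ht.1) (uniqueDiffOn_Ico 0 (Ts + 1))
    have hax' : ∀ t ∈ Ico 0 (Ts + 1), IsAxisymmetric (u t) := fun t ht => hax t ht.1
    obtain ⟨-, hblow⟩ := hall (Ts + 1) u p hcl' h0 (hLH (Ts + 1) (by linarith)) hax'
    exact (hblow (by linarith)).not_hasSmoothExtensionPast hΩ hTs ν 0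
      (hcl'.hasSmoothExtensionPast (by linarith))
  · -- finite branch: first close the energy class at `Tm` (weak `L²` final slice, tree theorem)
    obtain ⟨Y, -, hLHT⟩ := exists_isLerayHopfOn_update_of_forall_lt hTm hν hLH
    set ū : ℝ → E3 → E3 := Function.update u Tm Y with hū
    have hagree : ∀ t ∈ Ico 0 Tm, ū t = u t := fun t ht => Function.update_of_ne (ne_of_lt ht.2) Y u
    have hū0 : ū 0 = u₀ := by rw [hagree 0 ⟨le_rfl, hTm⟩, h0]
    have hclū : IsClassicalNSSolutionOn (Ico 0 Tm) ν 0 ū p := isClassicalNSSolutionOn_congr hcl hagree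
    have haxū : ∀ t ∈ Ico 0 Tm, IsAxisymmetric (ū t) := fun t ht => by rw [hagree t ht]; exact hax t ht
    obtain ⟨hbound, hblow⟩ := hall Tm ū p hclū hū0 hLHT haxū
    rcases lt_trichotomy Tm Ts with hlt | heq | hgt
    · -- the solution dies before `T*`: impossible by the a-priori velocity bound (i)
      exfalso
      obtain ⟨M, hM⟩ := hbound ((Tm + Ts) / 2) (by linarith)
      obtain ⟨t, ht, x, hx⟩ := hunb M
      have ht' : t ∈ Ico 0 (min Tm ((Tm + Ts) / 2)) := ⟨ht.1, lt_min ht.2 (by linarith [ht.2])⟩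
      have hle : ‖u t x‖ ≤ M := by rw [← hagree t ht]; exact hM t ht' x
      exact absurd hle (not_le.2 hx)
    · -- `Tm = T*`: the parts assemble; maximality from the localized vorticity blow-up
      subst heq
      refine ⟨ν, hν, Tm, hTm, ū, p, (hblow le_rfl).isMaximalSmoothSolution hΩ hTm hclū, ?_, ?_, ?_⟩
      · rw [hū0]; exact hLHT
      · rw [hū0]; exact hdec
      · rw [hū0]; exact hax₀
    · -- the solution lives beyond `T*`: it is its own classical continuation past the blow-up
      exfalso
      exact (hblow hgt.le).not_hasSmoothExtensionPast hΩ hTs ν 0 (hclū.hasSmoothExtensionPast hgt)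

/-- **Composition (the skeleton theorem).** The crux BY NAME from the two registered stubs, used by name:
`axisymBlowup_of_parts stub_lerayLocalTheory stub_aprioriLocalizedBlowup`; the crux `def` unfolds to exactly the
conclusion of the parts theorem. Placeholders occur only inside the two `stub_*`. -/
theorem certifiedBlowup_axisym_blowup_of : Theses.CertifiedBlowup.CertifiedBlowupAxisymBlowup :=
  axisymBlowup_of_parts stub_lerayLocalTheory stub_aprioriLocalizedBlowup

end Summit.NavierStokesRegularity.NavierStokesRegularity.Cruxes.CertifiedBlowupAxisymBlowup.AprioriParts

end
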